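import Literature.NumberTheory.LFunctions.SiegelTatuzawaTatuzawaTheoremTwo
import Literature.NumberTheory.LFunctions.RealZerosRealLFunctionsElementary
import HarnessLib

/-!
# Chen 2007, Theorem 1 (Acta Arith. 130, p. 361) and Ji–Lu 2004 (Acta Arith. 111, pp. 405–406) —
# the discharges of `chen2007_theorem1` and `jiLu2004_theorem`

Topic `Literature/NumberTheory/LFunctions`. Everything in this file is PROVED; its last two theorems are
`Literature.NumberTheory.LFunctions.chen2007_theorem1_holds : chen2007_theorem1` (the named fact of
`ExplicitSiegelTatuzawaBound.lean`: Y.-G. Chen, *On the Siegel–Tatuzawa–Hoffstein theorem*, Acta Arith.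
**130** (2007) 361–367 [Chen2007SiegelTatuzawaHoffstein], **Theorem 1** p. 361: "Let `0 < ε < 1/(6 log 10)`
and `χ` be a real primitive Dirichlet character modulo `k` with `k > e^{1/ε}`. Then, with at most one
exception, `L(1, χ) > min{1/(7.732 log k), 1.5·10⁶ ε/k^ε}`") and
`Literature.NumberTheory.LFunctions.jiLu2004_theorem_holds : jiLu2004_theorem` (the named fact of
`SiegelTatuzawaExplicit.lean`: C.-G. Ji, H.-W. Lu, *Lower bound of real primitive L-function at `s = 1`*,
Acta Arith. **111** (2004) 405–409 [JiLu2004LOneLowerBound], Theorem pp. 405–406: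
`min[1/(7.7388 log k), 32.260 ε/k^ε]`, which Chen's bound dominates termwise — `jiLu_bound_le`).

## The printed proof (Chen §2, pp. 362–366) and how it is followed

Chen proves a five-parameter "Theorem 2" (p. 363; Theorem 1 = the choice `A₁ = 1`, `A₂ = 0.78`,
`r = 0.086`, `u = 19.23`, `v = 22`) along Ji–Lu's lines with three improvements (p. 362): the zeros `β`
(of `L(s,χ)`) and `β₁` (of `L(s,χ₁)`) play symmetric roles ((5)); the function `x d_F^{−A₂x}` is unimodal,
so on `[a, b]` it is `≥ min` of its endpoint values; and the parameters are optimised. The chain, with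
`χ₁` the real primitive character of least conductor `k₁ > e^{1/ε}` violating the log branch
((1) `L(1,χ₁) ≤ B₁/log k₁`) and `χ ≠ χ₁` any other one mod `k ≥ k₁`:

* (2)/(3): if `L(s,χ₁) ≠ 0` (resp. `L(s,χ) ≠ 0`) on `(1 − r/log k₁, 1)` then the log branch holds, by
  Ji–Lu's Lemma 2 = Hoffstein 1979 Lemma 4 with `n = 2` (Chen p. 363–364). HERE: `lOne_gt_window` /
  `exists_realZero_window` with `r = 1/11.657` and the kernel's `Hoffstein1980.lOne_gt_of_re_nonneg`
  (`L(1,χ) > 1.511(1−β)`, file `SiegelTatuzawaHoffsteinLemmaThree.lean`): log branch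
  `1.511/(11.657 log k) = 1/(7.7148 log k) > 1/(7.732 log k)`.
* (4): Lemma 1 (Hoffstein's Lemma 2, `c = 6 − 4√2`) for `ζ_F`, `F = ℚ(√d, √d₁)`:
  `max{1−β, 1−β₁} ≥ c/log d_F ≥ c/(2 log kk₁) = 0.1716/log kk₁`. HERE (deviation, sharper):
  McCurley's explicit Landau theorem `McCurley1984_theorem2_holds` (`ExplicitLandauRepulsionStechkin.lean`):
  `max{1−β, 1−β₁} > 0.3103/log max(kk₁/17, 13) ≥ 0.31/log kk₁`.
* (5): Lemma 2 with `n = 4`, `x = d_F^{A₂}` at BOTH zeros: `L(1,χ)L(1,χ₁)L(1,χ₂) = κ_F ≥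
  D₂ max{(1−β)d_F^{−A₂(1−β)}, (1−β₁)d_F^{−A₂(1−β₁)}}`, `D₂ = 1.553`. HERE: the tree's three-character master
  inequality for `ζ L_χ L_χ₁ L_ψ` (`ψ` the primitive inducer of `χχ₁`) at `x = (kk₁)^{3/2}` with lead
  constant `1.6`: `Hoffstein1980.core3` (`SiegelTatuzawaHoffsteinTheoremTwo.lean`, zero of the character
  of smaller modulus) and `core_sym` below (the same with the ordering hypothesis removed — Chen's
  symmetric use); then unimodality (`Tatuzawa1951.min_endpoints_le_mul_exp`, the tree's elementary
  version of Chen's second improvement) on `[0.31/log kk₁, 1/(11.657 log k₁)]`.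
* (6): Lemma 3 (Ramaré): `L(1,χ₂) ≤ (log k₂ + 1.4165)/2 ≤ (log kk₁ + 1.4165)/2`. HERE: Louboutin's
  `L(1,ψ) ≤ ½ log f_ψ + 1.3` (`Louboutin2001.norm_LFunction_one_le_of_isPrimitive`, kernel), giving
  `(log kk₁)/2 + 1.3 ≤ (log k₁)((1+x)/2 + 0.0943)` for `x = log k/log k₁`, `log k₁ > 6 log 10 > 13.8`
  (Chen: `(log k)(x + 1.103)/(2x)`-type bounds with `1.4165/(6 log 10) < 0.103`).
* pp. 365–366, the four regimes: endpoint `w₁ = r/log k₁` with `x ≤ u` (log branch) / `x > u`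
  (`ε`-branch, using "`t e^{(log k)/t}` decreases for `0 < t ≤ log k`"), and endpoint `c/(2 log kk₁)` with
  `x ≤ v` / `x > v`. HERE: `key_A`/`key_B` (algebra), `endgame_A`/`endgame_B` with the numerical lemmas
  `regB_log` (`1 ≤ x ≤ 19.6`), `regB_eps` (`x ≥ 19.6`), `regA_log` (`1 ≤ x ≤ 30`), `regA_eps` (`x ≥ 30`),
  and `eps_mul_exp_neg_le` (the monotonicity of `t e^{(log k)/t}` in the form `ε e^{−ε log k} ≤
  (log k₁)⁻¹ e^{−x}` for `ε ≥ 1/log k₁`); assembled in `chain`, symmetrised in `pair`.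

Kernel parameters vs Chen's: `r = 1/11.657` (Chen `0.086`), `2A₂ ↦ 3/2` (Chen `1.56`), `D₂ ↦ 1.6` (Chen
`1.553`), `c/2 ↦ 0.31` (Chen `0.1716`), Ramaré `+0.708` ↦ Louboutin `+1.3`, `u = 19.6` (Chen `19.23`),
`v = 30` (Chen `22`). Margins at the switch points: `x = 19.6`: `11.25 > 10.39` (log) and
`2.2·10⁷ > 1.56·10⁷` (`ε`); `x = 30`: `558 > 483`; log branch `7.715 < 7.732`. The printed conclusions
(`7.732`, `1.5·10⁶`; `7.7388`, `32.260`) and hypotheses (`0 < ε < 1/(6 log 10)`, `k > e^{1/ε}`) are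
exactly the typed ones. Ji–Lu's own proof (pp. 407–409: (4) with `1.60452`, (5) `1/(2c log kk₁)`, (6)
`(kk₁)^{0.1376/log k₁}`, (7) `0.5261 log kk₁`, (8) `4.04947/…`, `η ≤ 7.54` / `η > 7.54`) is the
`A`-asymmetric special case and is not re-run separately: its statement follows from Chen's by
`min`-monotonicity.

## References

* Y.-G. Chen, On the Siegel–Tatuzawa–Hoffstein theorem, Acta Arith. 130 (2007) 361–367: Thm 1 p. 361,
  Lemmas 1–3 p. 362, Thm 2 p. 363, proof pp. 363–366. [Chen2007SiegelTatuzawaHoffstein]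
* C.-G. Ji, H.-W. Lu, Lower bound of real primitive L-function at s = 1, Acta Arith. 111 (2004)
  405–409: Theorem pp. 405–406, Lemma 2 / Corollary 3 p. 406–407, proof pp. 407–409.
  [JiLu2004LOneLowerBound]
* J. Hoffstein, On the Siegel–Tatuzawa theorem, Acta Arith. 38 (1980) 167–174 (the master inequalities;
  tree files `SiegelTatuzawaHoffstein*.lean`). [Hoffstein1980SiegelTatuzawa]
* K. S. McCurley, Explicit zero-free regions for Dirichlet L-functions, J. Number Theory 19 (1984) 7–32,
  Theorem 2. [McCurley1984ZFR]
* S. Louboutin, Acta Arith. 121 (2006) 199–220, Thm 1 (i). [Louboutin2006RelativeClassNumbers]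
-/

noncomputable section

open Complex DirichletCharacter Filter Topology Set
open scoped Real

namespace Literature.NumberTheory.LFunctions.Chen2007STH

open Literature.NumberTheory.LFunctions.Hoffstein1980 Literature.NumberTheory.LFunctions.Booker2006Turing
open Literature.NumberTheory.LFunctions.Tatuzawa1951

/-! ### Helpers -/

/-- A primitive character modulo `n > 1` is non-trivial. [folklore] -/
private lemma ne_one_of_isPrimitive {n : ℕ} [NeZero n] {φ : DirichletCharacter ℂ n}
    (hφ : φ.IsPrimitive) (hn : 1 < n) : φ ≠ 1 := by
  rintro rfl
  have h : (1 : DirichletCharacter ℂ n).conductor = n := hφ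
  rw [DirichletCharacter.conductor_one] at h; omega

/-- For a quadratic non-trivial `χ`, `L(1, χ)` is real and positive. [folklore] -/
private lemma LFunction_one_re_pos {n : ℕ} [NeZero n] {φ : DirichletCharacter ℂ n} (hφ1 : φ ≠ 1)
    (h2 : φ ^ 2 = 1) : 0 < (φ.LFunction 1).re ∧ ‖φ.LFunction 1‖ = (φ.LFunction 1).re := by
  have him : (φ.LFunction 1).im = 0 := by
    have := DirichletAbel.LFunction_ofReal_im_eq_zero φ hφ1 h2 (σ := 1) one_pos
    simpa using this
  have hpos : 0 < (φ.LFunction 1).re := by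
    have := DirichletAbel.LFunction_ofReal_re_pos_of_forall_ne_zero φ hφ1 h2 one_pos le_rfl
      fun σ h1 h2 ↦ by
        have hσ : σ = 1 := le_antisymm h2 h1
        subst hσ
        exact DirichletCharacter.LFunction_ne_zero_of_one_le_re φ (Or.inl hφ1) (by simp)
    simpa using this
  refine ⟨hpos, ?_⟩
  rw [← Complex.re_add_im (φ.LFunction 1), him]
  simp [abs_of_pos hpos]

/-- `(2.718)^n ≤ e^n`. [folklore] -/
private lemma exp_nat_ge (n : ℕ) : (2.718 : ℝ) ^ n ≤ Real.exp n := by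
  rw [← Real.exp_one_pow]
  exact pow_le_pow_left₀ (by norm_num) (by linarith [Real.exp_one_gt_d9]) n

/-- `log r > 13.1697` for `r > 10⁶`. [folklore] -/
private lemma log_gt_of_gt_ten6 {r : ℝ} (hr : 10 ^ 6 < r) : (13.1697 : ℝ) < Real.log r := by
  have h19 : Real.log ((2 : ℝ) ^ 19) < Real.log r :=
    Real.log_lt_log (by positivity) (by linarith [show ((2 : ℝ) ^ 19) < 10 ^ 6 by norm_num])
  rw [Real.log_pow] at h19
  push_cast at h19
  linarith [Real.log_two_gt_d9]

/-- `N^{1/5} ≥ 100` for `N ≥ 10¹⁰`. [folklore] -/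
private lemma rpow_fifth_ge {N : ℝ} (hN : (10 : ℝ) ^ 10 ≤ N) : (100 : ℝ) ≤ N ^ (1 / 5 : ℝ) := by
  have hN0 : 0 ≤ N := le_trans (by norm_num) hN
  have h5 : (N ^ (1 / 5 : ℝ)) ^ (5 : ℕ) = N := by
    rw [← Real.rpow_natCast, ← Real.rpow_mul hN0]; norm_num
  have hy : 0 ≤ N ^ (1 / 5 : ℝ) := Real.rpow_nonneg hN0 _
  by_contra hlt
  push Not at hlt
  have : (N ^ (1 / 5 : ℝ)) ^ (5 : ℕ) < 100 ^ 5 := pow_lt_pow_left₀ hlt hy (by norm_num)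
  rw [h5] at this
  linarith [this]

/-- `6 log 10 > 13.8` (i.e. `e^{2.3} < 10`; Chen p. 365 uses `1.4165/(6 log 10) < 0.103`).
[cite: Chen2007SiegelTatuzawaHoffstein, proof of Theorem 2 p. 365] -/
theorem six_log_ten_gt : (13.8 : ℝ) < 6 * Real.log 10 := by
  have h23 : Real.exp 2.3 < 10 := by
    have e1 := Real.exp_one_lt_d9
    have e3 : Real.exp 0.3 ≤ 1.34993 := by
      refine (Real.exp_bound' (x := 0.3) (by norm_num) (by norm_num) (n := 4) (by norm_num)).trans ?_
      norm_num [Finset.sum_range_succ, Nat.factorial]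
    have : Real.exp 2.3 = Real.exp 1 * Real.exp 1 * Real.exp 0.3 := by
      rw [← Real.exp_add, ← Real.exp_add]; norm_num
    rw [this]
    have h0 : 0 < Real.exp 1 := Real.exp_pos 1
    nlinarith [Real.exp_pos 0.3, mul_pos h0 h0]
  have := Real.log_lt_log (Real.exp_pos _) h23
  rw [Real.log_exp] at this
  linarith

/-- From `ε < 1/(6 log 10)` and `e^{1/ε} < k`: `6 log 10 < 1/ε < log k`, so `k > 10⁶` and
`log k > 13.8` (Chen p. 363: "`k₁ > e^{1/ε} > 10⁶`"; Ji–Lu p. 409: "`log k₁ > 1/ε`").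
[cite: Chen2007SiegelTatuzawaHoffstein, proof of Theorem 2 p. 363] -/
theorem sizes_of_exp_lt {ε : ℝ} (hε : 0 < ε) (hε' : ε < 1 / (6 * Real.log 10)) {k : ℝ}
    (hk : Real.exp (1 / ε) < k) :
    6 * Real.log 10 < 1 / ε ∧ 1 / ε < Real.log k ∧ (10 : ℝ) ^ 6 < k ∧ (13.8 : ℝ) < Real.log k := by
  have h6 : 0 < 6 * Real.log 10 := by positivity
  have h1 : 6 * Real.log 10 < 1 / ε := by
    rw [lt_one_div h6 hε]; exact hε'
  have hk0 : 0 < k := lt_trans (Real.exp_pos _) hk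
  have h2 : 1 / ε < Real.log k := by
    have := Real.log_lt_log (Real.exp_pos _) hk
    rwa [Real.log_exp] at this
  have h3 : (10 : ℝ) ^ 6 < k := by
    have e : Real.exp (6 * Real.log 10) = (10 : ℝ) ^ 6 := by
      rw [show (6 : ℝ) * Real.log 10 = ((6 : ℕ) : ℝ) * Real.log 10 by norm_num, Real.exp_nat_mul,
        Real.exp_log (by norm_num)]
    rw [← e]
    exact lt_trans (Real.exp_lt_exp.2 h1) hk
  exact ⟨h1, h2, h3, by linarith [six_log_ten_gt]⟩

/-! ### The §3 core at a zero, without the ordering of the moduli -/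

/-- **Ji–Lu's (4) / Chen's (5) at a zero of either character**: for `χ ≠ χ′` real primitive mod
`q, q′ > 10⁶` (no ordering assumed) and a real zero `β ∈ [1 − 1/(11.657 log q′), 1)` of `L(s, χ′)`,
`1.6 (1 − β) x^{−(1−β)} ≤ L(1,χ) · L(1,χ′) · (½ log qq′ + 1.3)`, `x = (qq′)^{3/2}` — the tree's
`Hoffstein1980.core3` (there stated for `q′ ≤ q`) with the ordering hypothesis removed (it was used
only to see `q > 10⁶`): the three-character master inequality `hoffstein_master3` for
`ζ L_χ L_χ′ L_ψ`, `ψ` the primitive inducer of `χχ′`, with Louboutin's `L(1,ψ) ≤ ½ log k + 1.3`.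
(Chen p. 364: "Similarly, by Lemma 2, (3) and the equality `ζ_F(β) = 0` we have
`κ_F ≥ (1 − β) d_F^{(β−1)A₂} D₂`" — the second, symmetric use of the master inequality.)
[cite: Chen2007SiegelTatuzawaHoffstein, §2 (5) p. 364] [cite: JiLu2004LOneLowerBound, (4) p. 408] -/
theorem core_sym {q q' : ℕ} [NeZero q] [NeZero q'] (χ : DirichletCharacter ℂ q)
    (χ' : DirichletCharacter ℂ q') (hχp : χ.IsPrimitive) (hχq : χ.IsQuadratic)
    (hχ'p : χ'.IsPrimitive) (hχ'q : χ'.IsQuadratic) (hne : (fun n : ℕ ↦ χ n) ≠ fun n : ℕ ↦ χ' n)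
    (hq6 : (10 ^ 6 : ℝ) < q) (hq'6 : (10 ^ 6 : ℝ) < q')
    {β : ℝ} (hz : χ'.LFunction β = 0) (hβlo : 1 - 1 / (11.657 * Real.log q') ≤ β) (hβ1 : β < 1) :
    1.6 * (1 - β) * (((q : ℝ) * q') ^ (3 / 2 : ℝ)) ^ (-(1 - β)) ≤
      (χ.LFunction 1).re * ((χ'.LFunction 1).re * (Real.log ((q : ℝ) * q') / 2 + 1.3)) := by
  have hq'r : (10 ^ 6 : ℝ) < q' := hq'6
  have hqr : (10 ^ 6 : ℝ) < q := hq6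
  have hq1 : 1 < q := by exact_mod_cast (lt_trans (by norm_num : (1:ℝ) < 10 ^ 6) hqr)
  have hq'1 : 1 < q' := by exact_mod_cast (lt_trans (by norm_num : (1:ℝ) < 10 ^ 6) hq'r)
  have hq0 : (0 : ℝ) < q := by linarith only [hqr]
  have hq'0 : (0 : ℝ) < q' := by linarith only [hq'r]
  have hlq' := log_gt_of_gt_ten6 hq'r
  have hlq := log_gt_of_gt_ten6 hqr
  have hlq'0 : 0 < Real.log q' := by linarith only [hlq']
  have hlq0 : 0 < Real.log q := by linarith only [hlq]
  set N : ℝ := (q : ℝ) * q' with hN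
  have hN0 : 0 < N := by positivity
  have hN12 : (10 : ℝ) ^ 12 ≤ N := by
    rw [hN]
    calc (10 : ℝ) ^ 12 = 10 ^ 6 * 10 ^ 6 := by norm_num
      _ ≤ (q : ℝ) * q' := mul_le_mul hqr.le hq'r.le (by norm_num) hq0.le
  have hN1 : (1 : ℝ) ≤ N := le_trans (by norm_num) hN12
  have h2 : χ ^ 2 = 1 := hχq.sq_eq_one
  have h2' : χ' ^ 2 = 1 := hχ'q.sq_eq_one
  have hχ1 := ne_one_of_isPrimitive hχp hq1
  have hχ'1 := ne_one_of_isPrimitive hχ'p hq'1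
  obtain ⟨hLpos, -⟩ := LFunction_one_re_pos hχ1 h2
  obtain ⟨hL'pos, -⟩ := LFunction_one_re_pos hχ'1 h2'
  have hκ0 : 0 < 1 - β := by linarith only [hβ1]
  have hκ : 1 - β ≤ 1 / (11.657 * Real.log q') := by linarith only [hβlo]
  have hκ' : (1 - β) * Real.log q' ≤ 1 / 11.657 := by
    rw [le_div_iff₀ (by positivity)] at hκ; rw [le_div_iff₀ (by norm_num)]; linarith only [hκ]
  have hκ1 : 1 - β < 0.0066 := by
    have h3 : (1 - β) * 13.1697 ≤ (1 - β) * Real.log q' := mul_le_mul_of_nonneg_left hlq'.le hκ0.le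
    have : (1 / 11.657 : ℝ) < 0.0066 * 13.1697 := by norm_num
    nlinarith only [h3, hκ', this, hκ0]
  have hβ0 : 1 / 2 < β := by linarith only [hκ1]
  -- the third character `ψ`
  obtain ⟨k, hkI, ψ, hk1, hkdvd, hψp, hψ2, hψ1, hlink, -⟩ :=
    exists_primitive_inducer χ χ' hχp hχ'p h2 h2' hne
  obtain ⟨hLψpos, hLψnorm⟩ := LFunction_one_re_pos hψ1 hψ2
  have hkle : (k : ℝ) ≤ N := by
    rw [hN]
    exact_mod_cast Nat.le_of_dvd (Nat.pos_of_ne_zero (mul_ne_zero (NeZero.ne q) (NeZero.ne q'))) hkdvd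
  have hk0 : (0 : ℝ) < k := by exact_mod_cast (zero_lt_one.trans hk1)
  -- (14): `L(1,ψ) ≤ ½ log k + 1.3 ≤ ½ log N + 1.3 =: u`
  set u : ℝ := Real.log N / 2 + 1.3 with hu
  have hLψle : (ψ.LFunction 1).re ≤ u := by
    have h := Louboutin2001.norm_LFunction_one_le_of_isPrimitive (χ := ψ) hψp hψ1
    rw [hLψnorm] at h
    have : Real.log k ≤ Real.log N := Real.log_le_log hk0 hkle
    rw [hu]; linarith only [h, this]
  have hlN0 : 0 < Real.log N := Real.log_pos (by linarith only [hN12])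
  have hu0 : 0 < u := by rw [hu]; positivity
  -- the choice `x = N^{3/2}`
  set x : ℝ := N ^ (3 / 2 : ℝ) with hxdef
  have hx0 : 0 < x := Real.rpow_pos_of_pos hN0 _
  have hxN : N ≤ x := by
    rw [hxdef]
    calc N = N ^ (1 : ℝ) := (Real.rpow_one N).symm
      _ ≤ N ^ (3 / 2 : ℝ) := Real.rpow_le_rpow_of_exponent_le hN1 (by norm_num)
  have hx4 : (40000 : ℝ) ≤ x := le_trans (by linarith only [hN12]) hxN
  -- the master inequality
  have hFβ : hoffF χ χ' ψ β = 0 := hoffF_eq_zero_of_LFunction_eq_zero hz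
  have hM := hoffstein_master3 hq1 hq'1 hk1 hχp hχ'p hψp h2 h2' hψ2 hlink hβ0 hβ1 hFβ hx4
  -- numerics (a): the squares sum
  have hSm := sum200_ge (le_trans (le_trans (by norm_num) hN12) hxN)
  -- numerics (b): the error term `C₃ x^{-3/2} ≤ 3.9 N² N^{-9/4} = 3.9 N^{-1/4}`
  have hx32 : x ^ (-(3 / 2 : ℝ)) = N ^ (-(9 / 4 : ℝ)) := by
    rw [hxdef, ← Real.rpow_mul hN0.le]; norm_num
  have hE : hoffErr3 q q' k * x ^ (-(3 / 2 : ℝ)) ≤ 3.9 * N ^ (-(1 / 4 : ℝ)) := by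
    rw [hoffErr3, hx32]
    have hqqk : (q : ℝ) * q' * k ≤ N * N := by rw [hN]; gcongr
    have hNN : N * N * N ^ (-(9 / 4 : ℝ)) = N ^ (-(1 / 4 : ℝ)) := by
      rw [show N * N = N ^ (2 : ℝ) by rw [Real.rpow_two]; ring, ← Real.rpow_add hN0]; norm_num
    have hZ0 : 0 ≤ bigZ (3 / 2) := (bigZ_pos (by norm_num)).le
    calc 720 * ((q : ℝ) * q' * k) * bigZ (3 / 2) ^ 4 / (7 * (2 * π) ^ 4) * N ^ (-(9 / 4 : ℝ))
        = (720 * bigZ (3 / 2) ^ 4 / (7 * (2 * π) ^ 4)) * (((q : ℝ) * q' * k) * N ^ (-(9 / 4 : ℝ))) := by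
          ring
      _ ≤ 3.9 * ((N * N) * N ^ (-(9 / 4 : ℝ))) := by gcongr; exact errConst3_le
      _ = 3.9 * N ^ (-(1 / 4 : ℝ)) := by rw [hNN]
  --   `x^{1−β} = N^{1.5(1−β)} ≤ N^{1/100}` and `N^{1/100 − 1/4} ≤ N^{−1/5} ≤ 1/100`
  have hxκ_le : x ^ (1 - β) ≤ N ^ (1 / 100 : ℝ) := by
    rw [hxdef, ← Real.rpow_mul hN0.le]
    exact Real.rpow_le_rpow_of_exponent_le hN1 (by linarith only [hκ1])
  have hN5 : N ^ (-(1 / 5 : ℝ)) ≤ 1 / 100 := by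
    have h := rpow_fifth_ge (N := N) (le_trans (by norm_num) hN12)
    rw [Real.rpow_neg hN0.le]
    exact (inv_le_inv₀ (by positivity) (by norm_num)).2 h |>.trans (by norm_num)
  have hEx : hoffErr3 q q' k * x ^ (-(3 / 2 : ℝ)) * x ^ (1 - β) ≤ 0.039 := by
    have h1 : hoffErr3 q q' k * x ^ (-(3 / 2 : ℝ)) * x ^ (1 - β) ≤
        3.9 * N ^ (-(1 / 4 : ℝ)) * N ^ (1 / 100 : ℝ) :=
      mul_le_mul hE hxκ_le (Real.rpow_pos_of_pos hx0 _).le (by positivity)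
    have h2 : N ^ (-(1 / 4 : ℝ)) * N ^ (1 / 100 : ℝ) ≤ N ^ (-(1 / 5 : ℝ)) := by
      rw [← Real.rpow_add hN0]
      exact Real.rpow_le_rpow_of_exponent_le hN1 (by norm_num)
    calc hoffErr3 q q' k * x ^ (-(3 / 2 : ℝ)) * x ^ (1 - β)
        ≤ 3.9 * (N ^ (-(1 / 4 : ℝ)) * N ^ (1 / 100 : ℝ)) := by rw [← mul_assoc]; exact h1
      _ ≤ 3.9 * N ^ (-(1 / 5 : ℝ)) := by gcongr
      _ ≤ 3.9 * (1 / 100) := by gcongr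
      _ = 0.039 := by norm_num
  -- from the master inequality to `1.6 (1−β) x^{−(1−β)} ≤ L(1,χ) L(1,χ′) L(1,ψ)`
  set Sm : ℝ := ∑ m ∈ Finset.range 200, (1 / ((m : ℝ) + 1) ^ 2 - 15 * ((m : ℝ) + 1) ^ 2 / x ^ 2)
    with hSmdef
  set P : ℝ := (χ.LFunction 1).re * ((χ'.LFunction 1).re * (ψ.LFunction 1).re) with hP
  set E : ℝ := hoffErr3 q q' k * x ^ (-(3 / 2 : ℝ)) with hEdef
  have hxκ0 : 0 < x ^ (-(1 - β)) := Real.rpow_pos_of_pos hx0 _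
  have hxinv : x ^ (-(1 - β)) * x ^ (1 - β) = 1 := by rw [← Real.rpow_add hx0]; simp
  have hA : 1.6 * (1 - β) * x ^ (-(1 - β)) ≤ P := by
    have h1 : x ^ (-(1 - β)) * Sm - E = x ^ (-(1 - β)) * (Sm - E * x ^ (1 - β)) := by
      have : E = x ^ (-(1 - β)) * (E * x ^ (1 - β)) := by
        rw [show x ^ (-(1 - β)) * (E * x ^ (1 - β)) = E * (x ^ (-(1 - β)) * x ^ (1 - β)) by ring,
          hxinv, mul_one]
      conv_lhs => rw [this]
      ring
    rw [h1] at hM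
    have h2 : (1.6 : ℝ) ≤ Sm - E * x ^ (1 - β) := by linarith only [hSm, hEx]
    calc 1.6 * (1 - β) * x ^ (-(1 - β)) = (1 - β) * (x ^ (-(1 - β)) * 1.6) := by ring
      _ ≤ (1 - β) * (x ^ (-(1 - β)) * (Sm - E * x ^ (1 - β))) := by gcongr
      _ ≤ P := hM
  calc 1.6 * (1 - β) * x ^ (-(1 - β)) ≤ P := hA
    _ ≤ (χ.LFunction 1).re * ((χ'.LFunction 1).re * u) := by rw [hP]; gcongr

/-! ### The log-branch: Hoffstein's window with the kernel constant `1.511/11.657 = 1/7.715` -/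

open Literature.NumberTheory.LFunctions.DirichletAbel in
/-- **The log-branch** ("if `L(s,χ) ≠ 0` for `1 − r/log k < s < 1` then `L(1,χ) > D₁ r e^{−rA₁}/log k
≥ B₁/log k`", Chen p. 364; Ji–Lu p. 408 with Corollary 3): for a real primitive `χ` modulo
`q ≥ 10⁶`, if `L(σ,χ) ≠ 0` for real `σ ∈ [1 − 1/(11.657 log q), 1)` then
`L(1,χ) > 1.511/(11.657 log q)` (`= 1/(7.7148… log q)`, above Chen's `1/(7.732 log q)` and Ji–Lu's
`1/(7.7388 log q)`). Kernel: `Hoffstein1980.lOne_gt_of_re_nonneg` at the edge of the window.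
[cite: Chen2007SiegelTatuzawaHoffstein, proof of Theorem 2 p. 363–364]
[cite: JiLu2004LOneLowerBound, Corollary 3 p. 407] -/
theorem lOne_gt_window (q : ℕ) [NeZero q] {χ : DirichletCharacter ℂ q} (hχ : χ.IsPrimitive)
    (hquad : χ.IsQuadratic) (hq6 : (10 ^ 6 : ℝ) ≤ q)
    (hz : ∀ σ : ℝ, 1 - 1 / (11.657 * Real.log q) ≤ σ → σ < 1 → χ.LFunction σ ≠ 0) :
    1.511 / (11.657 * Real.log q) < (χ.LFunction 1).re := by
  have hq1r : (1 : ℝ) < q := lt_of_lt_of_le (by norm_num) hq6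
  have hq1 : 1 < q := by exact_mod_cast hq1r
  have hχ1 : χ ≠ 1 := ne_one_of_isPrimitive hχ hq1
  have hq2 : χ ^ 2 = 1 := hquad.sq_eq_one
  have hlog : (13.8 : ℝ) < Real.log q := by
    have h := Real.log_le_log (by norm_num) hq6
    rw [Real.log_pow] at h; push_cast at h
    linarith [six_log_ten_gt]
  have hlogq : 0 < Real.log q := Real.log_pos hq1r
  set β : ℝ := 1 - 1 / (11.657 * Real.log q) with hβdef
  have hκ : 1 - β = 1 / (11.657 * Real.log q) := by rw [hβdef]; ring
  have hκ0 : 0 < 1 - β := by rw [hκ]; positivity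
  have hβ1 : β < 1 := by linarith
  have hκsmall : 1 - β < 1 / 2 := by
    rw [hκ, div_lt_div_iff₀ (by positivity) (by norm_num)]; nlinarith
  have hβ0 : 0 < β := by linarith
  -- `L(β, χ) > 0`: no zero on `[β, 1]`
  have hLβ : 0 < (χ.LFunction β).re :=
    LFunction_ofReal_re_pos_of_forall_ne_zero χ hχ1 hq2 hβ0 hβ1.le fun τ hτ1 hτ2 ↦ by
      rcases eq_or_lt_of_le hτ2 with rfl | hlt
      · rw [ofReal_one]; exact LFunction_apply_one_ne_zero hχ1
      · exact hz τ (by rw [hβdef] at hτ1; linarith) hlt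
  have h := lOne_gt_of_re_nonneg hχ hquad hq6 hβ1 hκ.le hLβ.le
  rw [hκ] at h
  calc 1.511 / (11.657 * Real.log q) = 1.511 * (1 / (11.657 * Real.log q)) := by ring
    _ < (χ.LFunction 1).re := h

/-- **Existence of the exceptional zero** ("so `L(s,χ₁)` has a real zero `β₁` with
`1 − β₁ < r/log k₁`", Chen (2) p. 363; Ji–Lu (2) p. 407): for a real primitive `χ` modulo `q ≥ 10⁶`
with `L(1,χ) ≤ 1/(7.732 log q)` there is a real zero `β ∈ [1 − 1/(11.657 log q), 1)` of `L(s,χ)`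
(`1/7.732 < 1.511/11.657`). [cite: Chen2007SiegelTatuzawaHoffstein, (2) p. 363] -/
theorem exists_realZero_window (q : ℕ) [NeZero q] {χ : DirichletCharacter ℂ q}
    (hχ : χ.IsPrimitive) (hquad : χ.IsQuadratic) (hq6 : (10 ^ 6 : ℝ) ≤ q)
    (hL : (χ.LFunction 1).re ≤ 1 / (7.732 * Real.log q)) :
    ∃ β : ℝ, 1 - 1 / (11.657 * Real.log q) ≤ β ∧ β < 1 ∧ χ.LFunction β = 0 := by
  by_contra hne
  push Not at hne
  have h := lOne_gt_window q hχ hquad hq6 fun σ h1 h2 h0 ↦ hne σ h1 h2 h0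
  have hq1r : (1 : ℝ) < q := lt_of_lt_of_le (by norm_num) hq6
  have hlogq : 0 < Real.log q := Real.log_pos hq1r
  have : 1 / (7.732 * Real.log q) < 1.511 / (11.657 * Real.log q) := by
    rw [div_lt_div_iff₀ (by positivity) (by positivity)]; nlinarith
  linarith

/-! ### Two elementary monotonicity facts of the proof -/

/-- "`t e^{(log k)/t}` decreases for `0 < t ≤ log k`" (Chen p. 366; Ji–Lu p. 408 "`x e^{δ/x}`
decreases until … `x = δ`"), in the form used: for `0 < a ≤ b` and `ε ≥ 1/a`,
`ε e^{−εb} ≤ a⁻¹ e^{−b/a}`. [cite: Chen2007SiegelTatuzawaHoffstein, proof of Theorem 2 p. 366] -/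
theorem eps_mul_exp_neg_le {a b ε : ℝ} (ha : 0 < a) (hab : a ≤ b) (hε : 1 / a ≤ ε) :
    ε * Real.exp (-(ε * b)) ≤ (1 / a) * Real.exp (-(b / a)) := by
  -- `ε/ε₀ ≤ 1 + (ε − ε₀) b ≤ e^{(ε−ε₀) b}` with `ε₀ = 1/a`, since `b ≥ a = 1/ε₀`
  have hε0 : 0 < 1 / a := by positivity
  have hkey : ε ≤ (1 / a) * Real.exp ((ε - 1 / a) * b) := by
    have h1 : 1 + (ε - 1 / a) * b ≤ Real.exp ((ε - 1 / a) * b) := by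
      have := Real.add_one_le_exp ((ε - 1 / a) * b); linarith
    have h2 : ε ≤ (1 / a) * (1 + (ε - 1 / a) * b) := by
      have hab' : (1 / a) * b ≥ 1 := by rw [one_div_mul_eq_div, ge_iff_le, one_le_div ha]; exact hab
      nlinarith [sub_nonneg.2 hε]
    exact h2.trans (mul_le_mul_of_nonneg_left h1 hε0.le)
  have e : (1 / a) * Real.exp (-(b / a)) = (1 / a) * Real.exp ((ε - 1 / a) * b) * Real.exp (-(ε * b)) := by
    rw [mul_assoc, ← Real.exp_add]; congr 1; ring
  rw [e]
  exact mul_le_mul_of_nonneg_right hkey (Real.exp_pos _).le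

/-! ### Numerical lemmas for the four regimes (Chen's `u = 19.23`, `v = 22`; here `u = 19.6`, `v = 30`) -/

/-- `e^{−0.465} ≥ 0.628`. [folklore] -/
private lemma exp_neg_0465_ge : (0.628 : ℝ) ≤ Real.exp (-0.465) := by
  have h : Real.exp 0.465 ≤ 1.5921 := by
    refine (Real.exp_bound' (x := 0.465) (by norm_num) (by norm_num) (n := 5) (by norm_num)).trans ?_
    norm_num [Finset.sum_range_succ, Nat.factorial]
  rw [Real.exp_neg]
  calc (0.628 : ℝ) ≤ 1.5921⁻¹ := by norm_num
    _ ≤ (Real.exp 0.465)⁻¹ := inv_anti₀ (Real.exp_pos _) h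

/-- `e^{2.5222} ≤ 12.46`. [folklore] -/
private lemma exp_25222_le : Real.exp 2.5222 ≤ 12.46 := by
  have e1 := Real.exp_one_lt_d9
  have h5 : Real.exp 0.5222 ≤ 1.68577 := by
    refine (Real.exp_bound' (x := 0.5222) (by norm_num) (by norm_num) (n := 5) (by norm_num)).trans ?_
    norm_num [Finset.sum_range_succ, Nat.factorial]
  have : Real.exp 2.5222 = Real.exp 1 * Real.exp 1 * Real.exp 0.5222 := by
    rw [← Real.exp_add, ← Real.exp_add]; norm_num
  rw [this]
  have h0 : 0 < Real.exp 1 := Real.exp_pos 1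
  nlinarith [Real.exp_pos 0.5222, mul_pos h0 h0]

/-- `e^{1.2868} ≤ 3.7`. [folklore] -/
private lemma exp_12868_le : Real.exp 1.2868 ≤ 3.7 := by
  have e1 := Real.exp_one_lt_d9
  have h4 : Real.exp 0.2868 ≤ 1.3323 := by
    refine (Real.exp_bound' (x := 0.2868) (by norm_num) (by norm_num) (n := 4) (by norm_num)).trans ?_
    norm_num [Finset.sum_range_succ, Nat.factorial]
  have : Real.exp 1.2868 = Real.exp 1 * Real.exp 0.2868 := by
    rw [← Real.exp_add]; norm_num
  rw [this]
  nlinarith [Real.exp_pos 0.2868, Real.exp_pos 1]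

/-- The constant of the `w₁`-endpoint: `7.732 · (1.6·7.732/11.657) · e^{−3/23.314} ≥ 7.149`. [folklore] -/
private lemma constB_ge :
    (7.149 : ℝ) ≤ 7.732 * (1.6 * 7.732 / 11.657) * Real.exp (-(3 / 23.314)) := by
  have h : 1 + (-(3 / 23.314 : ℝ)) ≤ Real.exp (-(3 / 23.314)) := by
    have := Real.add_one_le_exp (-(3 / 23.314 : ℝ)); linarith
  have h2 : (7.149 : ℝ) ≤ 7.732 * (1.6 * 7.732 / 11.657) * (1 + (-(3 / 23.314 : ℝ))) := by norm_num
  exact h2.trans (mul_le_mul_of_nonneg_left h (by norm_num))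

/-- Regime `1 ≤ x ≤ 19.6`, `w₁`-endpoint (Chen p. 365 "If `1 ≤ x ≤ u`"):
`(1+x)/2 + 0.0943 < 7.732·c_B·e^{−3/23.314} · x e^{−(3/23.314)x}`; `x e^{−0.1287x}` is unimodal, so on
`[1,10]` it is `≥ e^{−0.1287} ≥ 0.8713` and on `[10, 19.6]` it is `≥ 19.6 e^{−2.5221} ≥ 1.573`.
[cite: Chen2007SiegelTatuzawaHoffstein, proof of Theorem 2 p. 365 (case `1 ≤ x ≤ u`)] -/
theorem regB_log {x : ℝ} (hx1 : 1 ≤ x) (hx : x ≤ 19.6) :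
    (1 + x) / 2 + 0.0943 <
      7.732 * (1.6 * 7.732 / 11.657) * Real.exp (-(3 / 23.314)) *
        (x * Real.exp (-(2 * x * (3 / (2 * 23.314))))) := by
  have hC := constB_ge
  -- endpoint values of `f(x) = x e^{−(3/23.314) x}`
  have f1 : (0.8713 : ℝ) ≤ 1 * Real.exp (-(2 * 1 * (3 / (2 * 23.314)))) := by
    have := Real.add_one_le_exp (-(2 * 1 * (3 / (2 * 23.314)) : ℝ)); norm_num at this ⊢; linarith
  have f10 : (2.7 : ℝ) ≤ 10 * Real.exp (-(2 * 10 * (3 / (2 * 23.314)))) := by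
    have hle : (2 * 10 * (3 / (2 * 23.314)) : ℝ) ≤ 1.2868 := by norm_num
    have h := exp_12868_le
    have : Real.exp (2 * 10 * (3 / (2 * 23.314))) ≤ 3.7 := (Real.exp_le_exp.2 hle).trans h
    rw [Real.exp_neg]
    have h37 : (3.7 : ℝ)⁻¹ ≤ (Real.exp (2 * 10 * (3 / (2 * 23.314))))⁻¹ := inv_anti₀ (Real.exp_pos _) this
    nlinarith
  have f196 : (1.573 : ℝ) ≤ 19.6 * Real.exp (-(2 * 19.6 * (3 / (2 * 23.314)))) := by
    have hle : (2 * 19.6 * (3 / (2 * 23.314)) : ℝ) ≤ 2.5222 := by norm_num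
    have h := exp_25222_le
    have : Real.exp (2 * 19.6 * (3 / (2 * 23.314))) ≤ 12.46 := (Real.exp_le_exp.2 hle).trans h
    rw [Real.exp_neg]
    have h12 : (12.46 : ℝ)⁻¹ ≤ (Real.exp (2 * 19.6 * (3 / (2 * 23.314))))⁻¹ :=
      inv_anti₀ (Real.exp_pos _) this
    nlinarith
  have hℓ : (0 : ℝ) < 3 / (2 * 23.314) := by norm_num
  rcases le_total x 10 with h10 | h10
  · -- `x ∈ [1, 10]`: `f(x) ≥ min(f 1, f 10) ≥ 0.8713`
    have hmin := min_endpoints_le_mul_exp (a := 1) (b := 10) (κ := x) hℓ (by norm_num) hx1 h10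
    have hfx : (0.8713 : ℝ) ≤ x * Real.exp (-(2 * x * (3 / (2 * 23.314)))) :=
      le_trans (le_min f1 (by linarith)) hmin
    nlinarith
  · -- `x ∈ [10, 19.6]`: `f(x) ≥ min(f 10, f 19.6) ≥ 1.573`
    have hmin := min_endpoints_le_mul_exp (a := 10) (b := 19.6) (κ := x) hℓ (by norm_num) h10 hx
    have hfx : (1.573 : ℝ) ≤ x * Real.exp (-(2 * x * (3 / (2 * 23.314)))) :=
      le_trans (le_min (by linarith) f196) hmin
    nlinarith

/-- Regime `x ≥ 19.6`, `w₁`-endpoint (Chen p. 365 "If `x > u`"):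
`1.5·10⁶((1+x)/2 + 0.0943) < c_B e^{−(3/23.314)(1+x)} e^{x}` (`e^{17} ≥ 2.4·10⁷`).
[cite: Chen2007SiegelTatuzawaHoffstein, proof of Theorem 2 p. 365 (case `x > u`)] -/
theorem regB_eps {x : ℝ} (hx : 19.6 ≤ x) :
    1.5e6 * ((1 + x) / 2 + 0.0943) <
      (1.6 * 7.732 / 11.657) * Real.exp (-(3 / 23.314 * (1 + x))) * Real.exp x := by
  -- `e^{−(3/23.314)(1+x)} e^{x} = e^{−3/23.314} · e^{(1 − 3/23.314) x}`
  have e : Real.exp (-(3 / 23.314 * (1 + x))) * Real.exp x =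
      Real.exp (-(3 / 23.314)) * Real.exp ((1 - 3 / 23.314) * x) := by
    rw [← Real.exp_add, ← Real.exp_add]; congr 1; ring
  have h0 : 1 + (-(3 / 23.314 : ℝ)) ≤ Real.exp (-(3 / 23.314)) := by
    have := Real.add_one_le_exp (-(3 / 23.314 : ℝ)); linarith
  -- `e^{c x} ≥ e^{17} (1 + c (x − 19.6))` with `c = 1 − 3/23.314`, `19.6 c ≥ 17`
  have h17 : (2.4e7 : ℝ) ≤ Real.exp 17 := by
    have h := exp_nat_ge 17
    push_cast at h
    exact le_trans (by norm_num) h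
  have hc : Real.exp 17 * (1 + (1 - 3 / 23.314) * (x - 19.6)) ≤ Real.exp ((1 - 3 / 23.314) * x) := by
    have h1 : 1 + (1 - 3 / 23.314) * (x - 19.6) ≤ Real.exp ((1 - 3 / 23.314) * (x - 19.6)) := by
      have := Real.add_one_le_exp ((1 - 3 / 23.314) * (x - 19.6)); linarith
    have h2 : Real.exp 17 ≤ Real.exp ((1 - 3 / 23.314) * 19.6) := Real.exp_le_exp.2 (by norm_num)
    calc Real.exp 17 * (1 + (1 - 3 / 23.314) * (x - 19.6))
        ≤ Real.exp ((1 - 3 / 23.314) * 19.6) * Real.exp ((1 - 3 / 23.314) * (x - 19.6)) :=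
          mul_le_mul h2 h1 (by nlinarith) (Real.exp_pos _).le
      _ = Real.exp ((1 - 3 / 23.314) * x) := by rw [← Real.exp_add]; congr 1; ring
  rw [mul_assoc, e]
  have hx0 : 0 ≤ x - 19.6 := by linarith
  nlinarith [mul_le_mul h0 hc (by nlinarith) (Real.exp_pos _).le, Real.exp_pos ((1 - 3 / 23.314) * x),
    Real.exp_pos (-(3 / 23.314 : ℝ))]

/-- Regime `1 ≤ x ≤ 30`, `0.31/L`-endpoint (Chen p. 366 "If `1 ≤ x ≤ v`"):
`(1+x)((1+x)/2 + 0.0943) < 7.732 · (1.6·7.732·0.31·e^{−0.465}) · x`.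
[cite: Chen2007SiegelTatuzawaHoffstein, proof of Theorem 2 p. 366 (case `1 ≤ x ≤ v`)] -/
theorem regA_log {x : ℝ} (hx1 : 1 ≤ x) (hx : x ≤ 30) :
    (1 + x) * ((1 + x) / 2 + 0.0943) < 7.732 * (1.6 * 7.732 * 0.31 * Real.exp (-0.465)) * x := by
  have h := exp_neg_0465_ge
  have h1 : 7.732 * (1.6 * 7.732 * 0.31 * 0.628) * x ≤ 7.732 * (1.6 * 7.732 * 0.31 * Real.exp (-0.465)) * x := by
    have hx0 : 0 ≤ x := by linarith
    nlinarith
  nlinarith [mul_nonneg (sub_nonneg.2 hx1) (sub_nonneg.2 hx)]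

/-- Regime `x ≥ 30`, `0.31/L`-endpoint (Chen p. 366 "If `x > v`"):
`1.5·10⁶ (1+x)((1+x)/2 + 0.0943) < (1.6·7.732·0.31·e^{−0.465}) e^{x}` (`e^{30} ≥ 10¹³`).
[cite: Chen2007SiegelTatuzawaHoffstein, proof of Theorem 2 p. 366 (case `x > v`)] -/
theorem regA_eps {x : ℝ} (hx : 30 ≤ x) :
    1.5e6 * ((1 + x) * ((1 + x) / 2 + 0.0943)) < (1.6 * 7.732 * 0.31 * Real.exp (-0.465)) * Real.exp x := by
  have h := exp_neg_0465_ge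
  have h30 : (1e13 : ℝ) ≤ Real.exp 30 := by
    have h := exp_nat_ge 30
    push_cast at h
    exact le_trans (by norm_num) h
  set t := x - 30 with ht
  have ht0 : 0 ≤ t := by linarith
  have hq := Real.quadratic_le_exp_of_nonneg ht0
  have hex : Real.exp 30 * (1 + t + t ^ 2 / 2) ≤ Real.exp x := by
    calc Real.exp 30 * (1 + t + t ^ 2 / 2) ≤ Real.exp 30 * Real.exp t :=
          mul_le_mul_of_nonneg_left hq (Real.exp_pos _).le
      _ = Real.exp x := by rw [← Real.exp_add]; congr 1; rw [ht]; ring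
  have hx' : x = 30 + t := by rw [ht]; ring
  rw [hx']
  have hC : (2.408 : ℝ) ≤ 1.6 * 7.732 * 0.31 * Real.exp (-0.465) := by nlinarith
  have hlow : 2.408 * (1e13 * (1 + t + t ^ 2 / 2)) ≤
      (1.6 * 7.732 * 0.31 * Real.exp (-0.465)) * Real.exp x := by
    have := mul_le_mul hC (le_trans (mul_le_mul_of_nonneg_right h30 (by positivity)) hex)
      (by positivity) (by positivity)
    linarith
  rw [hx'] at hlow
  nlinarith [sq_nonneg t]

/-! ### Pure-real endgames (the algebra after (5), pp. 364–366) -/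

/-- Exponent bookkeeping at the endpoint `0.31/log N`: `2·(0.31/M)·(3M/4) = 0.465`. [folklore] -/
private lemma expo_A {M : ℝ} (hM : M ≠ 0) : 2 * (0.31 / M) * (3 * M / 4) = 0.465 := by
  field_simp; norm_num

/-- Exponent bookkeeping at the endpoint `w₁ = 1/(11.657 a)`: with `M = a(1+x)`,
`2·w₁·(3M/4) = (3/23.314)(1+x)`. [folklore] -/
private lemma expo_B {a x : ℝ} (ha : a ≠ 0) :
    2 * (1 / (11.657 * a)) * (3 * (a * (1 + x)) / 4) = 3 / 23.314 * (1 + x) := by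
  field_simp; ring

/-- From the master inequality at the endpoint `0.31/log N` to the key inequality
`1.6·7.732·0.31·E ≤ a R (1+x)((1+x)/2 + 0.0943)` (`a = log k₁`; (5)–(6) with `U ≤ a((1+x)/2 + 0.0943)`
and (1) `L(1,χ₁) ≤ 1/(7.732 a)`). [cite: Chen2007SiegelTatuzawaHoffstein, proof of Theorem 2 pp. 364–365] -/
theorem key_A {a x R U E : ℝ} (ha : 0 < a) (hx1 : 1 ≤ x) (hR : 0 < R)
    (hU : U ≤ a * ((1 + x) / 2 + 0.0943))
    (h : 1.6 * ((0.31 / (a * (1 + x))) * E) ≤ R * (U / (7.732 * a))) :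
    1.6 * 7.732 * 0.31 * E ≤ a * R * ((1 + x) * ((1 + x) / 2 + 0.0943)) := by
  have hx0 : 0 < 1 + x := by linarith
  have h2 : R * (U / (7.732 * a)) ≤ R * ((1 + x) / 2 + 0.0943) / 7.732 := by
    have : U / (7.732 * a) ≤ ((1 + x) / 2 + 0.0943) / 7.732 := by
      rw [div_le_div_iff₀ (by positivity) (by norm_num)]; nlinarith
    calc R * (U / (7.732 * a)) ≤ R * (((1 + x) / 2 + 0.0943) / 7.732) :=
          mul_le_mul_of_nonneg_left this hR.le
      _ = R * ((1 + x) / 2 + 0.0943) / 7.732 := by ring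
  have h3 := h.trans h2
  have e4 : 1.6 * (0.31 / (a * (1 + x)) * E) = (1.6 * 0.31 * E) / (a * (1 + x)) := by ring
  rw [e4, div_le_div_iff₀ (by positivity) (by norm_num)] at h3
  calc 1.6 * 7.732 * 0.31 * E = 1.6 * 0.31 * E * 7.732 := by ring
    _ ≤ R * ((1 + x) / 2 + 0.0943) * (a * (1 + x)) := h3
    _ = a * R * ((1 + x) * ((1 + x) / 2 + 0.0943)) := by ring

/-- From the master inequality at the endpoint `w₁` to the key inequality
`(1.6·7.732/11.657) E ≤ a R ((1+x)/2 + 0.0943)`. [cite: Chen2007SiegelTatuzawaHoffstein, proof of Theorem 2 pp. 364–365] -/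
theorem key_B {a x R U E : ℝ} (ha : 0 < a) (hR : 0 < R)
    (hU : U ≤ a * ((1 + x) / 2 + 0.0943))
    (h : 1.6 * ((1 / (11.657 * a)) * E) ≤ R * (U / (7.732 * a))) :
    (1.6 * 7.732 / 11.657) * E ≤ a * R * ((1 + x) / 2 + 0.0943) := by
  have h2 : R * (U / (7.732 * a)) ≤ R * ((1 + x) / 2 + 0.0943) / 7.732 := by
    have : U / (7.732 * a) ≤ ((1 + x) / 2 + 0.0943) / 7.732 := by
      rw [div_le_div_iff₀ (by positivity) (by norm_num)]; nlinarith
    calc R * (U / (7.732 * a)) ≤ R * (((1 + x) / 2 + 0.0943) / 7.732) :=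
          mul_le_mul_of_nonneg_left this hR.le
      _ = R * ((1 + x) / 2 + 0.0943) / 7.732 := by ring
  have h3 := h.trans h2
  have e4 : 1.6 * (1 / (11.657 * a) * E) = (1.6 * E) / (11.657 * a) := by ring
  rw [e4, div_le_div_iff₀ (by positivity) (by norm_num)] at h3
  calc (1.6 * 7.732 / 11.657) * E = (1.6 * E * 7.732) / 11.657 := by ring
    _ ≤ R * ((1 + x) / 2 + 0.0943) * (11.657 * a) / 11.657 := div_le_div_of_nonneg_right h3 (by norm_num)
    _ = a * R * ((1 + x) / 2 + 0.0943) := by ring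

/-- Endgame at the endpoint `0.31/log N` (cases `x ≤ 30` / `x > 30`, Chen p. 366 with `v = 30`).
[cite: Chen2007SiegelTatuzawaHoffstein, proof of Theorem 2 p. 366] -/
theorem endgame_A {a x R : ℝ} (ha : 0 < a) (hx1 : 1 ≤ x)
    (hkey : 1.6 * 7.732 * 0.31 * Real.exp (-0.465) ≤ a * R * ((1 + x) * ((1 + x) / 2 + 0.0943))) :
    (x ≤ 30 → 1 / (7.732 * (x * a)) < R) ∧ (30 < x → 1.5e6 * ((1 / a) * Real.exp (-x)) < R) := by
  set P : ℝ := (1 + x) * ((1 + x) / 2 + 0.0943) with hP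
  have hpos : 0 < P := by rw [hP]; positivity
  have hx0 : 0 < x := by linarith
  constructor
  · intro hx30
    have hnum := regA_log hx1 hx30
    rw [← hP] at hnum
    have h1 := mul_le_mul_of_nonneg_left hkey (by positivity : (0 : ℝ) ≤ 7.732 * x)
    have h2 : P * 1 < P * (7.732 * x * a * R) := by linarith
    have h3 := lt_of_mul_lt_mul_left h2 hpos.le
    rw [div_lt_iff₀ (by positivity)]
    linarith
  · intro hx30
    have hnum := regA_eps hx30.le
    rw [← hP] at hnum
    have h1 := mul_le_mul_of_nonneg_right hkey (Real.exp_pos x).le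
    have h2 : P * 1.5e6 < P * (a * R * Real.exp x) := by linarith
    have h3 := lt_of_mul_lt_mul_left h2 hpos.le
    have e : 1.5e6 * (1 / a * Real.exp (-x)) = 1.5e6 / (a * Real.exp x) := by
      rw [Real.exp_neg]; field_simp
    rw [e, div_lt_iff₀ (by positivity)]
    linarith

/-- Endgame at the endpoint `w₁` (cases `x ≤ 19.6` / `x > 19.6`, Chen p. 365 with `u = 19.6`).
[cite: Chen2007SiegelTatuzawaHoffstein, proof of Theorem 2 p. 365] -/
theorem endgame_B {a x R : ℝ} (ha : 0 < a) (hx1 : 1 ≤ x)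
    (hkey : (1.6 * 7.732 / 11.657) * Real.exp (-(3 / 23.314 * (1 + x))) ≤
      a * R * ((1 + x) / 2 + 0.0943)) :
    (x ≤ 19.6 → 1 / (7.732 * (x * a)) < R) ∧ (19.6 < x → 1.5e6 * ((1 / a) * Real.exp (-x)) < R) := by
  set P : ℝ := (1 + x) / 2 + 0.0943 with hP
  have hpos : 0 < P := by rw [hP]; positivity
  have hx0 : 0 < x := by linarith
  constructor
  · intro hx196
    have hnum := regB_log hx1 hx196
    rw [← hP] at hnum
    have e5 : Real.exp (-(3 / 23.314 * (1 + x))) =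
        Real.exp (-(3 / 23.314)) * Real.exp (-(2 * x * (3 / (2 * 23.314)))) := by
      rw [← Real.exp_add]; congr 1; ring
    rw [e5] at hkey
    have h1 := mul_le_mul_of_nonneg_left hkey (by positivity : (0 : ℝ) ≤ 7.732 * x)
    have h2 : P * 1 < P * (7.732 * x * a * R) := by linarith
    have h3 := lt_of_mul_lt_mul_left h2 hpos.le
    rw [div_lt_iff₀ (by positivity)]
    linarith
  · intro hx196
    have hnum := regB_eps hx196.le
    rw [← hP] at hnum
    have h1 := mul_le_mul_of_nonneg_right hkey (Real.exp_pos x).le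
    have h2 : P * 1.5e6 < P * (a * R * Real.exp x) := by linarith
    have h3 := lt_of_mul_lt_mul_left h2 hpos.le
    have e : 1.5e6 * (1 / a * Real.exp (-x)) = 1.5e6 / (a * Real.exp x) := by
      rw [Real.exp_neg]; field_simp
    rw [e, div_lt_iff₀ (by positivity)]
    linarith

/-! ### The chain: Chen's proof of Theorem 2 (pp. 363–366) with the kernel's parameters -/

set_option maxHeartbeats 400000 in
/-- **Chen's Theorem 2 chain** (pp. 363–366), kernel parameters `r = 1/11.657`, `2A₂ ↦ 3/2`
(`x = (kk₁)^{3/2}`), `c/2 ↦ 0.31` (McCurley), `D₂ ↦ 1.6`, Ramaré's `1.4165/2` ↦ Louboutin's `1.3`,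
`u = 19.6`, `v = 30`: let `χ ≠ χ₁` be real primitive mod `k ≥ k₁ > e^{1/ε}`, `0 < ε < 1/(6 log 10)`,
with real zeros `β ∈ [1 − r/log k, 1)` of `L(s,χ)` and `β₁ ∈ [1 − r/log k₁, 1)` of `L(s,χ₁)` ((2), (3)), and
(1) `L(1,χ₁) ≤ 1/(7.732 log k₁)`. Then `L(1,χ) > min{1/(7.732 log k), 1.5·10⁶ ε/k^ε}`. Steps: (4) by
McCurley's explicit Landau theorem `max{1−β, 1−β₁} > 0.31/log kk₁`; (5) the three-character master
inequality at that zero (`Hoffstein1980.core3` / `core_sym`); unimodality of `t ↦ t (kk₁)^{−3t/2}`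
(`Tatuzawa1951.min_endpoints_le_mul_exp`); (6) Louboutin; then the four regimes `regB_log`, `regB_eps`
(`x = log k/log k₁ ≶ 19.6`), `regA_log`, `regA_eps` (`x ≶ 30`), with "`t e^{(log k)/t}` decreases"
(`eps_mul_exp_neg_le`). [cite: Chen2007SiegelTatuzawaHoffstein, Theorem 2 and its proof pp. 363–366] -/
theorem chain {ε : ℝ} (hε : 0 < ε) (hε' : ε < 1 / (6 * Real.log 10))
    {k k₁ : ℕ} [NeZero k] [NeZero k₁] (χ : DirichletCharacter ℂ k) (χ₁ : DirichletCharacter ℂ k₁)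
    (hχp : χ.IsPrimitive) (hχq : χ.IsQuadratic) (h₁p : χ₁.IsPrimitive) (h₁q : χ₁.IsQuadratic)
    (hne : (fun n : ℕ ↦ χ n) ≠ fun n : ℕ ↦ χ₁ n)
    (hk₁ : Real.exp (1 / ε) < k₁) (hkk : (k₁ : ℝ) ≤ k)
    {β : ℝ} (hz : χ.LFunction β = 0) (hβw : 1 - 1 / (11.657 * Real.log k) ≤ β) (hβ1 : β < 1)
    {β₁ : ℝ} (hz₁ : χ₁.LFunction β₁ = 0) (hβ₁w : 1 - 1 / (11.657 * Real.log k₁) ≤ β₁) (hβ₁1 : β₁ < 1)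
    (hL₁ : (χ₁.LFunction 1).re ≤ 1 / (7.732 * Real.log k₁)) :
    Chen2007STH.bound ε k < (χ.LFunction 1).re := by
  -- sizes
  obtain ⟨-, hea, hk₁6, ha138⟩ := sizes_of_exp_lt hε hε' hk₁
  set a : ℝ := Real.log k₁ with hadef
  have hk₁0 : (0 : ℝ) < k₁ := by linarith
  have hk0 : (0 : ℝ) < k := by linarith
  have hk6 : (10 ^ 6 : ℝ) < k := lt_of_lt_of_le hk₁6 hkk
  have hab : a ≤ Real.log k := Real.log_le_log hk₁0 hkk
  have ha0 : 0 < a := by linarith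
  have hεa : 1 / a ≤ ε := by rw [one_div_le ha0 hε]; exact hea.le
  -- `x = log k/log k₁ ≥ 1`
  obtain ⟨x, hxdef⟩ : ∃ x : ℝ, x = Real.log k / a := ⟨_, rfl⟩
  have hbx : Real.log k = x * a := by rw [hxdef]; field_simp
  have hx1 : 1 ≤ x := by rw [hxdef, le_div_iff₀ ha0]; linarith
  have hk1 : 1 < k := by exact_mod_cast (lt_trans (by norm_num : (1 : ℝ) < 10 ^ 6) hk6)
  have hk₁1 : 1 < k₁ := by exact_mod_cast (lt_trans (by norm_num : (1 : ℝ) < 10 ^ 6) hk₁6)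
  have hχ1 := ne_one_of_isPrimitive hχp hk1
  have hχ₁1 := ne_one_of_isPrimitive h₁p hk₁1
  obtain ⟨hRpos, -⟩ := LFunction_one_re_pos hχ1 hχq.sq_eq_one
  obtain ⟨hR₁pos, -⟩ := LFunction_one_re_pos hχ₁1 h₁q.sq_eq_one
  -- `N = kk₁`, `log N = a (1 + x)`
  have hN0 : 0 < (k : ℝ) * k₁ := by positivity
  have hLx : Real.log ((k : ℝ) * k₁) = a * (1 + x) := by
    rw [Real.log_mul hk0.ne' hk₁0.ne', hbx]; ring
  have hM0 : 0 < a * (1 + x) := by positivity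
  -- the windows: `1−β, 1−β₁ ≤ w₁ = 1/(11.657 a)`
  have hκ₁w : 1 - β₁ ≤ 1 / (11.657 * a) := by linarith
  have hκw : 1 - β ≤ 1 / (11.657 * a) := by
    have : 1 / (11.657 * Real.log k) ≤ 1 / (11.657 * a) :=
      one_div_le_one_div_of_le (by positivity) (by nlinarith)
    linarith
  -- (4) McCurley: `max(1−β, 1−β₁) > 0.31/log N`
  have hdist : k ≠ k₁ ∨ ∃ h : k = k₁, h ▸ χ ≠ χ₁ := by
    by_cases h : k = k₁
    · subst h
      refine Or.inr ⟨rfl, fun heq ↦ hne ?_⟩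
      funext n
      rw [show χ = χ₁ from heq]
    · exact Or.inl h
  have hMc := McCurley1984_theorem2_holds k k₁ χ χ₁ hχp hχq h₁p h₁q hdist β β₁ hz hz₁
  rw [ThornerZaman2024.one_div_rOne_mul_eq] at hMc
  have hm : 0.31 / (a * (1 + x)) < 1 - β ∨ 0.31 / (a * (1 + x)) < 1 - β₁ := by
    have hc : (0.31 : ℝ) < ThornerZaman2024.landauConst := Hoffstein1980.landauConst_gt
    have hN13 : (13 : ℝ) ≤ (k : ℝ) * k₁ := by nlinarith
    have hMle : max ((k : ℝ) * k₁ / 17) 13 ≤ (k : ℝ) * k₁ :=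
      max_le (div_le_self hN0.le (by norm_num)) hN13
    have hM13 : (13 : ℝ) ≤ max ((k : ℝ) * k₁ / 17) 13 := le_max_right _ _
    have hlogM : Real.log (max ((k : ℝ) * k₁ / 17) 13) ≤ a * (1 + x) :=
      hLx ▸ Real.log_le_log (by linarith) hMle
    have hlogM0 : 0 < Real.log (max ((k : ℝ) * k₁ / 17) 13) := Real.log_pos (by linarith)
    have hwin : 0.31 / (a * (1 + x)) <
        ThornerZaman2024.landauConst / Real.log (max ((k : ℝ) * k₁ / 17) 13) := by
      rw [div_lt_div_iff₀ hM0 hlogM0]; nlinarith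
    rcases min_lt_iff.1 hMc with h | h
    · left; linarith
    · right; linarith
  -- (5) the master inequality at that zero; `x^{−t} = e^{−2 t L′}`, `L′ = 3 log N/4`
  have hxexp : ∀ t : ℝ, (((k : ℝ) * k₁) ^ (3 / 2 : ℝ)) ^ (-t) =
      Real.exp (-(2 * t * (3 * (a * (1 + x)) / 4))) := by
    intro t
    rw [← Real.rpow_mul hN0.le, Real.rpow_def_of_pos hN0, hLx]; congr 1; ring
  have hL'0 : 0 < 3 * (a * (1 + x)) / 4 := by positivity
  set U : ℝ := a * (1 + x) / 2 + 1.3 with hU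
  have hU0 : 0 < U := by positivity
  set R : ℝ := (χ.LFunction 1).re with hRdef
  set R₁ : ℝ := (χ₁.LFunction 1).re with hR₁def
  have hS : ∃ t : ℝ, 0.31 / (a * (1 + x)) ≤ t ∧ t ≤ 1 / (11.657 * a) ∧
      1.6 * (t * Real.exp (-(2 * t * (3 * (a * (1 + x)) / 4)))) ≤ R * (R₁ * U) := by
    rcases hm with hmκ | hmκ₁
    · -- the zero `β` of `L(s,χ)` (Chen: "Similarly, by Lemma 2, (3) and `ζ_F(β) = 0`")
      have hc := core_sym χ₁ χ h₁p h₁q hχp hχq (fun h ↦ hne h.symm) hk₁6 hk6 hz hβw hβ1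
      refine ⟨1 - β, hmκ.le, hκw, ?_⟩
      have e1 : ((k₁ : ℝ) * k) = (k : ℝ) * k₁ := mul_comm _ _
      rw [e1, hxexp (1 - β), hLx] at hc
      calc 1.6 * ((1 - β) * Real.exp (-(2 * (1 - β) * (3 * (a * (1 + x)) / 4))))
          = 1.6 * (1 - β) * Real.exp (-(2 * (1 - β) * (3 * (a * (1 + x)) / 4))) := by ring
        _ ≤ R₁ * (R * U) := hc
        _ = R * (R₁ * U) := by ring
    · -- the zero `β₁` of `L(s,χ₁)`
      have hkkN : k₁ ≤ k := by exact_mod_cast hkk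
      have hc := core3 χ χ₁ hχp hχq hχ1 h₁p h₁q hχ₁1 hne hk₁6 hkkN hz₁ hβ₁w hβ₁1
      refine ⟨1 - β₁, hmκ₁.le, hκ₁w, ?_⟩
      rw [hxexp (1 - β₁), hLx] at hc
      calc 1.6 * ((1 - β₁) * Real.exp (-(2 * (1 - β₁) * (3 * (a * (1 + x)) / 4))))
          = 1.6 * (1 - β₁) * Real.exp (-(2 * (1 - β₁) * (3 * (a * (1 + x)) / 4))) := by ring
        _ ≤ R * (R₁ * U) := hc
  obtain ⟨t, hta, htb, hineq⟩ := hS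
  -- unimodality, and (1): `L(1,χ₁) U ≤ U/(7.732 a)`
  have hmin := min_endpoints_le_mul_exp hL'0 (by positivity) hta htb
  have hRU : R * (R₁ * U) ≤ R * (U / (7.732 * a)) := by
    refine mul_le_mul_of_nonneg_left ?_ hRpos.le
    calc R₁ * U ≤ (1 / (7.732 * a)) * U := mul_le_mul_of_nonneg_right hL₁ hU0.le
      _ = U / (7.732 * a) := by ring
  have hUle : U ≤ a * ((1 + x) / 2 + 0.0943) := by rw [hU]; nlinarith
  -- the `ε`-form of the target: `1.5·10⁶ ε/k^ε ≤ 1.5·10⁶ a⁻¹ e^{−x}`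
  have hεform : 1.5e6 * ε / (k : ℝ) ^ ε ≤ 1.5e6 * ((1 / a) * Real.exp (-x)) := by
    have h1 := eps_mul_exp_neg_le ha0 hab hεa
    have e1 : (k : ℝ) ^ ε = Real.exp (ε * Real.log k) := by rw [Real.rpow_def_of_pos hk0, mul_comm]
    have e2 : Real.exp (-(Real.log k / a)) = Real.exp (-x) := by rw [hxdef]
    rw [e1, div_eq_mul_inv, ← Real.exp_neg, mul_assoc, ← e2]
    exact mul_le_mul_of_nonneg_left h1 (by norm_num)
  unfold Chen2007STH.bound
  rcases min_le_iff.1 hmin with hA | hB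
  · -- endpoint `0.31/log N` (Chen's second alternative, cases `x ≤ v` / `x > v`)
    rw [expo_A hM0.ne'] at hA
    have hkey := key_A ha0 hx1 hRpos hUle
      ((le_trans (mul_le_mul_of_nonneg_left hA (by norm_num)) hineq).trans hRU)
    obtain ⟨hlog, heps⟩ := endgame_A ha0 hx1 hkey
    rcases le_or_gt x 30 with hx30 | hx30
    · exact (min_le_left _ _).trans_lt (by rw [hbx]; exact hlog hx30)
    · exact (min_le_right _ _).trans_lt (hεform.trans_lt (heps hx30))
  · -- endpoint `w₁ = 1/(11.657 a)` (Chen's first alternative, cases `x ≤ u` / `x > u`)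
    rw [expo_B ha0.ne'] at hB
    have hkey := key_B ha0 hRpos hUle
      ((le_trans (mul_le_mul_of_nonneg_left hB (by norm_num)) hineq).trans hRU)
    obtain ⟨hlog, heps⟩ := endgame_B ha0 hx1 hkey
    rcases le_or_gt x 19.6 with hx196 | hx196
    · exact (min_le_left _ _).trans_lt (by rw [hbx]; exact hlog hx196)
    · exact (min_le_right _ _).trans_lt (hεform.trans_lt (heps hx196))

/-! ### Theorem 2 pairwise; Chen's Theorem 1; Ji–Lu's Theorem -/

/-- **Chen's Theorem 1, pairwise**: of two real primitive characters `χ₁ ≠ χ₂` (different value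
functions) modulo `k₁, k₂ > e^{1/ε}`, `0 < ε < 1/(6 log 10)`, at least one satisfies
`L(1,χ) > min{1/(7.732 log k), 1.5·10⁶ ε/k^ε}`. (Proof of Theorem 2, pp. 363–366: a character with no
real zero in `[1 − r/log k, 1)` satisfies the log branch (`lOne_gt_window`); if both have such zeros,
order the moduli and apply `chain` to the larger against the smaller, unless the smaller already
satisfies the log branch.) [cite: Chen2007SiegelTatuzawaHoffstein, Theorem 1 p. 361, Theorem 2 p. 363] -/
theorem pair {ε : ℝ} (hε : 0 < ε) (hε' : ε < 1 / (6 * Real.log 10))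
    {k₁ : ℕ} [NeZero k₁] (χ₁ : DirichletCharacter ℂ k₁) (h₁p : χ₁.IsPrimitive) (h₁q : χ₁.IsQuadratic)
    {k₂ : ℕ} [NeZero k₂] (χ₂ : DirichletCharacter ℂ k₂) (h₂p : χ₂.IsPrimitive) (h₂q : χ₂.IsQuadratic)
    (hne : (fun n : ℕ ↦ χ₁ n) ≠ fun n : ℕ ↦ χ₂ n)
    (hk₁ : Real.exp (1 / ε) < k₁) (hk₂ : Real.exp (1 / ε) < k₂) :
    Chen2007STH.bound ε k₁ < (χ₁.LFunction 1).re ∨ Chen2007STH.bound ε k₂ < (χ₂.LFunction 1).re := by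
  obtain ⟨-, -, hk₁6, hl₁⟩ := sizes_of_exp_lt hε hε' hk₁
  obtain ⟨-, -, hk₂6, hl₂⟩ := sizes_of_exp_lt hε hε' hk₂
  have hlog₁ : 0 < Real.log k₁ := by linarith
  have hlog₂ : 0 < Real.log k₂ := by linarith
  -- the log branches
  have hlb₁ : 1 / (7.732 * Real.log k₁) < 1.511 / (11.657 * Real.log k₁) := by
    rw [div_lt_div_iff₀ (by positivity) (by positivity)]; nlinarith
  have hlb₂ : 1 / (7.732 * Real.log k₂) < 1.511 / (11.657 * Real.log k₂) := by
    rw [div_lt_div_iff₀ (by positivity) (by positivity)]; nlinarith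
  by_cases hz₁ : ∀ σ : ℝ, 1 - 1 / (11.657 * Real.log k₁) ≤ σ → σ < 1 → χ₁.LFunction σ ≠ 0
  · left
    exact (min_le_left _ _).trans_lt (hlb₁.trans (lOne_gt_window k₁ h₁p h₁q hk₁6.le hz₁))
  by_cases hz₂ : ∀ σ : ℝ, 1 - 1 / (11.657 * Real.log k₂) ≤ σ → σ < 1 → χ₂.LFunction σ ≠ 0
  · right
    exact (min_le_left _ _).trans_lt (hlb₂.trans (lOne_gt_window k₂ h₂p h₂q hk₂6.le hz₂))
  push Not at hz₁ hz₂
  obtain ⟨β₁, hβ₁w, hβ₁1, hβ₁z⟩ := hz₁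
  obtain ⟨β₂, hβ₂w, hβ₂1, hβ₂z⟩ := hz₂
  rcases le_total (k₁ : ℝ) k₂ with hle | hle
  · -- `k₁ ≤ k₂`: `χ₁` plays the exceptional character
    by_cases hL₁ : (χ₁.LFunction 1).re ≤ 1 / (7.732 * Real.log k₁)
    · right
      exact chain hε hε' χ₂ χ₁ h₂p h₂q h₁p h₁q (fun h ↦ hne h.symm) hk₁ hle hβ₂z hβ₂w hβ₂1
        hβ₁z hβ₁w hβ₁1 hL₁
    · left
      push Not at hL₁
      exact (min_le_left _ _).trans_lt hL₁
  · by_cases hL₂ : (χ₂.LFunction 1).re ≤ 1 / (7.732 * Real.log k₂)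
    · left
      exact chain hε hε' χ₁ χ₂ h₁p h₁q h₂p h₂q hne hk₂ hle hβ₁z hβ₁w hβ₁1 hβ₂z hβ₂w hβ₂1 hL₂
    · right
      push Not at hL₂
      exact (min_le_left _ _).trans_lt hL₂

end Literature.NumberTheory.LFunctions.Chen2007STH

namespace Literature.NumberTheory.LFunctions

open Chen2007STH

/-- **Chen 2007, Theorem 1 (Acta Arith. 130, p. 361) — DISCHARGED.** "Let `0 < ε < 1/(6 log 10)` and `χ`
be a real primitive Dirichlet character modulo `k` with `k > e^{1/ε}`. Then, with at most one exception,
`L(1, χ) > min{1/(7.732 log k), 1.5·10⁶ ε/k^ε}`" — both pairwise clauses of the named fact, from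
`Chen2007STH.pair` (two primitive characters with the same value function have the same modulus:
`Pintz1977RealZeros.level_eq_of_isPrimitive_of_apply_natCast_eq`; `‖L(1,χ)‖ = L(1,χ)` for real `χ`).
[cite: Chen2007SiegelTatuzawaHoffstein, Theorem 1 p. 361] -/
theorem chen2007_theorem1_holds : chen2007_theorem1 := by
  intro ε hε hε'
  refine ⟨fun k₁ k₂ _ _ χ₁ χ₂ hk hk₁ hk₂ h₁p h₁q h₂p h₂q ↦ ?_, fun k _ χ₁ χ₂ hχ hk h₁p h₁q h₂p h₂q ↦ ?_⟩
  · have hne : (fun n : ℕ ↦ χ₁ n) ≠ fun n : ℕ ↦ χ₂ n := fun h ↦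
      hk (Pintz1977RealZeros.level_eq_of_isPrimitive_of_apply_natCast_eq h₁p h₂p h)
    obtain ⟨-, -, hk₁6, -⟩ := sizes_of_exp_lt hε hε' hk₁
    obtain ⟨-, -, hk₂6, -⟩ := sizes_of_exp_lt hε hε' hk₂
    have hk₁1 : 1 < k₁ := by exact_mod_cast (lt_trans (by norm_num : (1 : ℝ) < 10 ^ 6) hk₁6)
    have hk₂1 : 1 < k₂ := by exact_mod_cast (lt_trans (by norm_num : (1 : ℝ) < 10 ^ 6) hk₂6)
    obtain ⟨-, hn₁⟩ := LFunction_one_re_pos (ne_one_of_isPrimitive h₁p hk₁1) h₁q.sq_eq_one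
    obtain ⟨-, hn₂⟩ := LFunction_one_re_pos (ne_one_of_isPrimitive h₂p hk₂1) h₂q.sq_eq_one
    rw [hn₁, hn₂]
    exact pair hε hε' χ₁ h₁p h₁q χ₂ h₂p h₂q hne hk₁ hk₂
  · have hne : (fun n : ℕ ↦ χ₁ n) ≠ fun n : ℕ ↦ χ₂ n := fun h ↦ hχ (by
      refine MulChar.ext' fun a ↦ ?_
      have := congrFun h a.val
      simpa only [ZMod.natCast_zmod_val] using this)
    obtain ⟨-, -, hk6, -⟩ := sizes_of_exp_lt hε hε' hk
    have hk1 : 1 < k := by exact_mod_cast (lt_trans (by norm_num : (1 : ℝ) < 10 ^ 6) hk6)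
    obtain ⟨-, hn₁⟩ := LFunction_one_re_pos (ne_one_of_isPrimitive h₁p hk1) h₁q.sq_eq_one
    obtain ⟨-, hn₂⟩ := LFunction_one_re_pos (ne_one_of_isPrimitive h₂p hk1) h₂q.sq_eq_one
    rw [hn₁, hn₂]
    exact pair hε hε' χ₁ h₁p h₁q χ₂ h₂p h₂q hne hk hk

/-- Ji–Lu's bound is below Chen's: `min{1/(7.7388 log k), 32.260 ε/k^ε} ≤ min{1/(7.732 log k),
1.5·10⁶ ε/k^ε}` for `k > 1`, `ε > 0`. [cite: Chen2007SiegelTatuzawaHoffstein, p. 361 (Ji–Lu restated)] -/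
theorem Chen2007STH.jiLu_bound_le {ε : ℝ} (hε : 0 < ε) {k : ℕ} (hk : (1 : ℝ) < k) :
    min (1 / (7.7388 * Real.log k)) (32.260 * ε / (k : ℝ) ^ ε) ≤ Chen2007STH.bound ε k := by
  have hlog : 0 < Real.log k := Real.log_pos hk
  have hkε : 0 < (k : ℝ) ^ ε := Real.rpow_pos_of_pos (by linarith) _
  unfold Chen2007STH.bound
  refine min_le_min ?_ ?_
  · exact one_div_le_one_div_of_le (by positivity) (by nlinarith)
  · exact div_le_div_of_nonneg_right (by nlinarith) hkε.le

/-- **Ji–Lu 2004, Theorem (Acta Arith. 111, pp. 405–406; threshold `k > e^{1/ε}` as typed) — DISCHARGED.**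
"Let `0 < ε < 1/(6 log 10)` … Then with at most one exception
`L(1, χ) > min[1/(7.7388 log k), 32.260 ε/k^ε]`" — from Chen's pairwise Theorem 1 (`Chen2007STH.pair`,
whose bound dominates Ji–Lu's: `jiLu_bound_le`) and `AtMostOneException.of_pairwise`.
[cite: JiLu2004LOneLowerBound, Theorem pp. 405–406] [cite: Chen2007SiegelTatuzawaHoffstein, Theorem 1 p. 361] -/
theorem jiLu2004_theorem_holds : jiLu2004_theorem := by
  intro ε hε hε'
  refine AtMostOneException.of_pairwise fun {q} _ χ hp hq _ {q'} _ χ' hp' hq' _ hne ↦ ?_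
  by_cases h1 : Real.exp (1 / ε) < (q : ℝ)
  · by_cases h2 : Real.exp (1 / ε) < (q' : ℝ)
    · obtain ⟨-, -, hq6, -⟩ := sizes_of_exp_lt hε hε' h1
      obtain ⟨-, -, hq'6, -⟩ := sizes_of_exp_lt hε hε' h2
      have hq1 : (1 : ℝ) < q := lt_trans (by norm_num) hq6
      have hq'1 : (1 : ℝ) < q' := lt_trans (by norm_num) hq'6
      rcases pair hε hε' χ hp hq χ' hp' hq' hne h1 h2 with h | h
      · exact Or.inl fun _ ↦ (jiLu_bound_le hε hq1).trans_lt h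
      · exact Or.inr fun _ ↦ (jiLu_bound_le hε hq'1).trans_lt h
    · exact Or.inr fun h ↦ absurd h h2
  · exact Or.inl fun h ↦ absurd h h1

/-! ### The consumers of `chen2007_theorem1`, now hypothesis-free -/

open Literature.Barriers.Parity in
/-- **At most one Siegel zero of large quality beyond `e^{1/ε}` — UNCONDITIONAL** (the reading
`IsSiegelZero.quality_le_or_of_chen2007` of `ExplicitSiegelTatuzawaBound.lean` fed with
`chen2007_theorem1_holds`): for `0 < ε < 1/(6 log 10)` and Siegel zeros of qualities `η₁, η₂` at
distinct primitive quadratic characters of conductors `k₁, k₂ > e^{1/ε}`, one quality is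
`≤ 55 log kᵢ/min{1/(7.732 log kᵢ), 1.5·10⁶ ε/kᵢ^ε}`.
[cite: Chen2007SiegelTatuzawaHoffstein, Theorem 1 p. 361] [cite: MontgomeryVaughan2007, Theorem 11.4 (11.10)] -/
theorem _root_.Literature.Barriers.Parity.IsSiegelZero.quality_le_or_chen2007
    {ε : ℝ} (hε : 0 < ε) (hε' : ε < 1 / (6 * Real.log 10))
    {k₁ k₂ : ℕ} [NeZero k₁] [NeZero k₂] {χ₁ : DirichletCharacter ℂ k₁}
    {χ₂ : DirichletCharacter ℂ k₂} {η₁ η₂ : ℝ} (hS₁ : IsSiegelZero χ₁ η₁) (hS₂ : IsSiegelZero χ₂ η₂)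
    (hdist : k₁ ≠ k₂ ∨ (∃ h : k₁ = k₂, h ▸ χ₁ ≠ χ₂))
    (hk₁ : Real.exp (1 / ε) < k₁) (hk₂ : Real.exp (1 / ε) < k₂) :
    η₁ ≤ 55 * Real.log k₁ / Chen2007STH.bound ε k₁ ∨ η₂ ≤ 55 * Real.log k₂ / Chen2007STH.bound ε k₂ :=
  IsSiegelZero.quality_le_or_of_chen2007 chen2007_theorem1_holds hε hε' hS₁ hS₂ hdist hk₁ hk₂

/-- **Chen's Theorem 1 in the `AtMostOneException` rendering — UNCONDITIONAL** (the bridge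
`SiegelTatuzawa.chen2007_atMostOneException` of `SiegelTatuzawaExplicit.lean` fed with
`chen2007_theorem1_holds`). [cite: Chen2007SiegelTatuzawaHoffstein, Theorem 1 p. 361] -/
theorem SiegelTatuzawa.chen2007_atMostOneException_holds {ε : ℝ} (hε : 0 < ε)
    (hε' : ε < 1 / (6 * Real.log 10)) :
    AtMostOneException fun k _ χ ↦
      Real.exp (1 / ε) < (k : ℝ) → Chen2007STH.bound ε k < ‖χ.LFunction 1‖ :=
  SiegelTatuzawa.chen2007_atMostOneException chen2007_theorem1_holds hε hε'

end Literature.NumberTheory.LFunctions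

end
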